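import Literature.NumberTheory.GaloisRepresentations.SerreWeightEqTwoShapesProofs
import Literature.NumberTheory.GaloisRepresentations.SerreSubgroupsGL2Fp
import Literature.NumberTheory.GaloisRepresentations.RamificationFiltrationProofs
import HarnessLib

/-!
# Serre's weight `k(ρ̄) = 2q` for the wild shape `(1 *; 0 χ)` (Serre 1987, §2.4, (2.4.5)/(2.4.8))

`Proofs` file (theorems only, no definition, no named fact, no `sorry`), topic
`Literature/NumberTheory/GaloisRepresentations`; sibling of `SerreWeightProofs`
(`serreWeightLocal_eq_two_holds`, shape `(χ *; 0 1)` peu ramifiée ↦ `k = 2`) and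
`SerreWeightTresRamifieeProofs` (`(χ *; 0 1)` très ramifiée ↦ `k = q + 1`).

## The statements

Let `F` be a non-archimedean local field with residue field of cardinality `q ≠ 2`,
`ρ̄ : Γ_F → GL₂(k)` a mod `p` representation (`ModPGaloisRep`), `χ = ψ₁` the level-one fundamental
character (`fundamentalCharacter F 1 ι ϖ hϖ`).

* `HasLevelOneInertiaShape.fundamentalCharacter_pow_eq_of_not_isTamelyRamified` — **the diagonal
  characters of a WILD level-one shape are unique**: if `ρ̄` is wildly ramified and
  `ρ̄|I_F ∼ (χ^β *; 0 χ^α)` and also `∼ (χ^{β'} *; 0 χ^{α'})`, then `χ^β = χ^{β'}` and `χ^α = χ^{α'}`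
  (a non-trivial unipotent `ρ̄(σ₀)`, `σ₀ ∈ I_F^v`, `v > 0`, has a unique fixed line, which is the
  stable line of both shapes; then compare determinants).  Serre, §2.4: "les entiers `α, β` sont
  bien déterminés modulo `p - 1`" in the wild case (2.4.2)–(2.4.3).
* `serreWeightLocal_eq_two_mul_residueFieldCard` — **`k(ρ̄) = 2q` for `ρ̄|I_F ∼ (1 *; 0 χ)` wild and
  peu ramifiée**: the normalised exponents are `β = q - 1`, `α = 1`, so `a = 1`, `b = q - 1` and
  `k = 1 + q a + b = 2q` by (2.4.5) when `q > 3` (`β ≠ α + 1`) and by (2.4.8) (peu ramifiée,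
  `β = α + 1`) when `q = 3`, where `k = 2 + α (q + 1) = 6`.  This is the value `k = 6 = 2p` of
  Edixhoven's dictionary for `ρ̄_{E,3}` at a curve of Kodaira type III of the tame quartic class
  (item W23b of route `TameQuarticManinParity`; [cite: ConradDiamondTaylor1999, Conj. 1.2.3]:
  `(1 *; 0 ω)` peu ramifié ↦ `k = 6`).

## References

* [Serre1987] J.-P. Serre, *Sur les représentations modulaires de degré 2 de Gal(ℚ̄/ℚ)*, Duke
  Math. J. 54 (1987), §2.4: (2.4.2)–(2.4.3) (normalisation of `α, β`), (2.4.5)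
  (`k = 1 + pa + b` if `β ≠ α + 1`), (ii₁) (2.4.8) (`k = 1 + pa + b` if `β = α + 1` and `ρ̄` peu
  ramifiée); §2.1 Prop. 1.
* [Edixhoven1992] B. Edixhoven, Invent. Math. 109 (1992), Def. 4.3.
* [ConradDiamondTaylor1999] B. Conrad, F. Diamond, R. Taylor, J. Amer. Math. Soc. 12 (1999),
  Conj. 1.2.3 (the table `k ∈ {2, 6}` at `ℓ = 3`).
-/

noncomputable section

open scoped Valued Matrix
open Field ValuativeRel

namespace Literature.NumberTheory.GaloisRepresentations
namespace ModPGaloisRep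

open GaloisRepresentations.IsNonarchimedeanLocalField

universe u v

variable {F : Type u} [Field F] [ValuativeRel F] [TopologicalSpace F] [IsNonarchimedeanLocalField F]
variable {k : Type v} [Field k] [TopologicalSpace k]
variable {ρ : ModPGaloisRep F k 2} {ι : absIntegers 𝒪[F] F ⧸ absMaximalIdeal F →+* k}

omit [TopologicalSpace k] in
/-- `!![a, c; 0, d] e₀ = a e₀`. [folklore] -/
private theorem upper_mulVec_single_zero (a c d : k) :
    !![a, c; 0, d] *ᵥ Pi.single 0 1 = a • Pi.single 0 1 := by
  ext i
  fin_cases i <;> simp [Matrix.mulVec, dotProduct, Fin.sum_univ_two]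

omit [TopologicalSpace k] in
/-- If `P g P⁻¹ = (a c; 0 d)` then `g (P⁻¹ e₀) = a · P⁻¹ e₀`. [folklore] -/
private theorem mulVec_eq_smul_of_conj_eq {P g : GL (Fin 2) k} {a c d : k}
    (h : ((P * g * P⁻¹ : GL (Fin 2) k) : Matrix (Fin 2) (Fin 2) k) = !![a, c; 0, d]) :
    (g : Matrix (Fin 2) (Fin 2) k) *ᵥ (((P⁻¹ : GL (Fin 2) k) : Matrix (Fin 2) (Fin 2) k) *ᵥ
      Pi.single 0 1) =
      a • (((P⁻¹ : GL (Fin 2) k) : Matrix (Fin 2) (Fin 2) k) *ᵥ Pi.single 0 1) := by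
  have hg : (g : Matrix (Fin 2) (Fin 2) k) = ((P⁻¹ : GL (Fin 2) k) : Matrix (Fin 2) (Fin 2) k) *
      ((P * g * P⁻¹ : GL (Fin 2) k) : Matrix (Fin 2) (Fin 2) k) *
        ((P : GL (Fin 2) k) : Matrix (Fin 2) (Fin 2) k) := by
    rw [← Units.val_mul, ← Units.val_mul]
    congr 1
    group
  have hPP : ((P : GL (Fin 2) k) : Matrix (Fin 2) (Fin 2) k) *ᵥ
      ((((P⁻¹ : GL (Fin 2) k) : Matrix (Fin 2) (Fin 2) k)) *ᵥ (Pi.single 0 1 : Fin 2 → k)) =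
      Pi.single 0 1 := by
    rw [Matrix.mulVec_mulVec, ← Units.val_mul, mul_inv_cancel, Units.val_one, Matrix.one_mulVec]
  rw [hg, ← Matrix.mulVec_mulVec, ← Matrix.mulVec_mulVec, hPP, h, upper_mulVec_single_zero,
    Matrix.mulVec_smul]

omit [TopologicalSpace k] in
/-- If `P g P⁻¹ = (a c; 0 d)` then `det g = a d`. [folklore] -/
private theorem det_eq_of_conj_eq {P g : GL (Fin 2) k} {a c d : k}
    (h : ((P * g * P⁻¹ : GL (Fin 2) k) : Matrix (Fin 2) (Fin 2) k) = !![a, c; 0, d]) :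
    ((Matrix.GeneralLinearGroup.det g : kˣ) : k) = a * d := by
  have h1 : Matrix.GeneralLinearGroup.det (P * g * P⁻¹) = Matrix.GeneralLinearGroup.det g := by
    rw [map_mul, map_mul, map_inv, mul_inv_cancel_comm]
  rw [← h1, Matrix.GeneralLinearGroup.val_det_apply, h, Matrix.det_fin_two_of, mul_zero, sub_zero]

omit [TopologicalSpace k] in
/-- `P⁻¹ e₀ ≠ 0`. [folklore] -/
private theorem inv_mulVec_single_zero_ne_zero (P : GL (Fin 2) k) :
    (((P⁻¹ : GL (Fin 2) k) : Matrix (Fin 2) (Fin 2) k) *ᵥ Pi.single 0 1) ≠ 0 := by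
  intro h
  have h1 : ((P : GL (Fin 2) k) : Matrix (Fin 2) (Fin 2) k) *ᵥ
      ((((P⁻¹ : GL (Fin 2) k) : Matrix (Fin 2) (Fin 2) k)) *ᵥ Pi.single 0 1) =
      (Pi.single 0 1 : Fin 2 → k) := by
    rw [Matrix.mulVec_mulVec, ← Units.val_mul, mul_inv_cancel, Units.val_one, Matrix.one_mulVec]
  rw [h, Matrix.mulVec_zero] at h1
  exact one_ne_zero ((congrFun h1 0).symm.trans (by simp))

/-- **The diagonal characters of a wild level-one shape are unique.**  If `ρ̄_F` is wildly
ramified and `ρ̄|I_F ∼ (ψ₁^β *; 0 ψ₁^α)` (w.r.t. a uniformiser `ϖ`) and also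
`ρ̄|I_F ∼ (ψ₁^{β'} *; 0 ψ₁^{α'})` (w.r.t. `ϖ'`; the level-one fundamental characters for `ϖ, ϖ'`
coincide, `fundamentalCharacter_eq_holds`), then `ψ₁^β = ψ₁^{β'}` and `ψ₁^α = ψ₁^{α'}` on `I_F`:
a wild element `σ₀ ∈ I_F^v`, `v > 0`, with `ρ̄(σ₀) ≠ 1` is a non-trivial unipotent in both bases
(`ψ₁` is tame), its fixed line is unique and is the stable line of both shapes, on which `I_F`
acts through `ψ₁^β = ψ₁^{β'}`; the determinant gives the other character.  Serre: in the wild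
case the integers `α, β` are well defined modulo `p - 1`.
[cite: Serre1987, §2.4 (2.4.2)–(2.4.3)] [cite: Serre1987, §2.1 Prop. 1] -/
theorem HasLevelOneInertiaShape.fundamentalCharacter_pow_eq_of_not_isTamelyRamified
    (hw : ¬ ρ.IsTamelyRamified) {ϖ ϖ' : 𝒪[F]} (hϖ : Irreducible ϖ) (hϖ' : Irreducible ϖ')
    {β α β' α' : ℕ} (h : ρ.HasLevelOneInertiaShape ι ϖ hϖ β α)
    (h' : ρ.HasLevelOneInertiaShape ι ϖ' hϖ' β' α') :
    (∀ σ : absInertia F,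
        fundamentalCharacter F 1 ι ϖ hϖ σ ^ β = fundamentalCharacter F 1 ι ϖ hϖ σ ^ β') ∧
      ∀ σ : absInertia F,
        fundamentalCharacter F 1 ι ϖ hϖ σ ^ α = fundamentalCharacter F 1 ι ϖ hϖ σ ^ α' := by
  have hχ' : fundamentalCharacter F 1 ι ϖ' hϖ' = fundamentalCharacter F 1 ι ϖ hϖ :=
    fundamentalCharacter_eq_holds F 1 ι ϖ' ϖ hϖ' hϖ
  obtain ⟨P, hP⟩ := h
  obtain ⟨Q, hQ⟩ := h'
  -- a wild element `σ₀ ∈ I_F^v`, `v > 0`, with `ρ̄(σ₀) ≠ 1`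
  have hw' := hw
  unfold IsTamelyRamified at hw'
  push Not at hw'
  obtain ⟨v, hv, σ₀', hσ₀v, hσ₀⟩ := hw'
  have hσ₀I : σ₀' ∈ absInertia F := absUpperInertia_le_absInertia_holds F v hσ₀v
  set σ₀ : absInertia F := ⟨σ₀', hσ₀I⟩ with hσ₀def
  have hψσ₀ : fundamentalCharacter F 1 ι ϖ hϖ σ₀ = 1 :=
    fundamentalCharacter_apply_eq_one_of_mem_absUpperInertia (F := F) one_ne_zero ι ϖ hϖ hv σ₀ hσ₀v
  -- the two stable vectors `v_P = P⁻¹ e₀`, `v_Q = Q⁻¹ e₀`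
  set vP : Fin 2 → k := (((P⁻¹ : GL (Fin 2) k) : Matrix (Fin 2) (Fin 2) k) *ᵥ Pi.single 0 1)
    with hvPdef
  set vQ : Fin 2 → k := (((Q⁻¹ : GL (Fin 2) k) : Matrix (Fin 2) (Fin 2) k) *ᵥ Pi.single 0 1)
    with hvQdef
  have hvP0 : vP ≠ 0 := inv_mulVec_single_zero_ne_zero P
  have hvQ0 : vQ ≠ 0 := inv_mulVec_single_zero_ne_zero Q
  have hPv : ∀ σ : absInertia F, (ρ (σ : absoluteGaloisGroup F) : Matrix (Fin 2) (Fin 2) k) *ᵥ vP =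
      ((fundamentalCharacter F 1 ι ϖ hϖ σ ^ β : kˣ) : k) • vP := fun σ ↦ by
    obtain ⟨c, hc⟩ := hP σ
    exact mulVec_eq_smul_of_conj_eq hc
  have hQv : ∀ σ : absInertia F, (ρ (σ : absoluteGaloisGroup F) : Matrix (Fin 2) (Fin 2) k) *ᵥ vQ =
      ((fundamentalCharacter F 1 ι ϖ hϖ σ ^ β' : kˣ) : k) • vQ := fun σ ↦ by
    obtain ⟨c, hc⟩ := hQ σ
    rw [hχ'] at hc
    exact mulVec_eq_smul_of_conj_eq hc
  -- `N = ρ̄(σ₀) - 1 ≠ 0` kills both, so `v_Q = t v_P`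
  set N : Matrix (Fin 2) (Fin 2) k := (ρ (σ₀ : absoluteGaloisGroup F) : Matrix (Fin 2) (Fin 2) k) - 1
    with hNdef
  have hN0 : N ≠ 0 := by
    intro hN
    apply hσ₀
    exact Units.ext (sub_eq_zero.mp hN)
  have hNvP : N *ᵥ vP = 0 := by
    rw [hNdef, Matrix.sub_mulVec, Matrix.one_mulVec, sub_eq_zero, hPv σ₀, hψσ₀, one_pow,
      Units.val_one, one_smul]
  have hNvQ : N *ᵥ vQ = 0 := by
    rw [hNdef, Matrix.sub_mulVec, Matrix.one_mulVec, sub_eq_zero, hQv σ₀, hψσ₀, one_pow,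
      Units.val_one, one_smul]
  obtain ⟨t, ht⟩ := Serre1972.exists_eq_smul_of_mulVec_eq_zero hN0 hvP0 hNvP hNvQ
  have ht0 : t ≠ 0 := by
    rintro rfl
    rw [zero_smul] at ht
    exact hvQ0 ht
  -- compare the two actions on the common line
  have hβ : ∀ σ : absInertia F,
      fundamentalCharacter F 1 ι ϖ hϖ σ ^ β = fundamentalCharacter F 1 ι ϖ hϖ σ ^ β' := by
    intro σ
    have h1 := hQv σ
    rw [ht, Matrix.mulVec_smul, hPv σ, smul_smul, smul_smul] at h1
    have h2 := smul_left_injective k hvP0 h1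
    rw [mul_comm] at h2
    exact Units.ext (mul_right_cancel₀ ht0 h2)
  refine ⟨hβ, fun σ ↦ ?_⟩
  -- determinants: `ψ^β ψ^α = det = ψ^β' ψ^α'`
  obtain ⟨c, hc⟩ := hP σ
  obtain ⟨c', hc'⟩ := hQ σ
  rw [hχ'] at hc'
  have hd := (det_eq_of_conj_eq hc).symm.trans (det_eq_of_conj_eq hc')
  rw [← Units.val_mul, ← Units.val_mul, hβ σ] at hd
  exact mul_left_cancel (Units.ext hd)

/-- **`k(ρ̄_F) = 2q` for the wild, peu ramifiée shape `(1 *; 0 χ)`.**  If `q ≠ 2`, `ρ̄_F` is wildly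
ramified and peu ramifiée, and `ρ̄|I_F ∼ (χ^{q-1} *; 0 χ) = (1 *; 0 χ)` (`χ = ψ₁`), then Serre's
weight is `serreWeightLocal ρ̄ ι = 2q`: the normalised exponents are `β = q - 1`, `α = 1`
(unique, `fundamentalCharacter_pow_eq_of_not_isTamelyRamified` and `χ` of exact order `q - 1`),
so `a = min(α, β) = 1`, `b = q - 1`, and `k = 1 + q a + b = 2q` by (2.4.5) (`β ≠ α + 1`,
`q > 3`) resp. (2.4.8) (`β = α + 1`, `q = 3`, peu ramifiée: `k = 2 + α(q+1) = 6`).  The level-two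
and tame cases of the recipe do not occur (`HasLevelTwoInertiaShape.isTamelyRamified_holds`).
For `F = ℚ₃` and `ρ̄ = ρ̄_{E,3}`, `E/ℚ` of Kodaira type III in the tame quartic class, this is
the value `k = 6` ([cite: ConradDiamondTaylor1999, Conj. 1.2.3]).
[cite: Serre1987, §2.4 (2.4.5) and (ii₁) (2.4.8)] -/
theorem serreWeightLocal_eq_two_mul_residueFieldCard (hq : residueFieldCard F ≠ 2)
    (hw : ¬ ρ.IsTamelyRamified) (hpeu : ρ.IsPeuRamifie) {ϖ : 𝒪[F]} (hϖ : Irreducible ϖ)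
    (h : ρ.HasLevelOneInertiaShape ι ϖ hϖ (residueFieldCard F - 1) 1) :
    ρ.serreWeightLocal ι = 2 * residueFieldCard F := by
  classical
  have hι : Function.Injective ι := residueEmbedding_injective ι
  have hq1 := one_lt_residueFieldCard F
  have hntres : ¬ ρ.IsTresRamifie := fun ht ↦ (ρ.isTresRamifie_iff_not_isPeuRamifie.mp ht) hpeu
  have h2 : ¬ ∃ m, ρ.IsLevelTwoWeight ι m := fun ⟨m, hm⟩ ↦
    hw (IsLevelTwoWeight.isTamelyRamified_of HasLevelTwoInertiaShape.isTamelyRamified_holds hm)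
  -- `2q` is a level-one wild weight (`α = 1`, `β = q - 1`)
  have hmem : ρ.IsLevelOneWildWeight ι (2 * residueFieldCard F) := by
    refine ⟨hw, 1, residueFieldCard F - 1, by omega, by omega, by omega, ⟨ϖ, hϖ, h⟩, ?_⟩
    rw [if_neg fun hc ↦ hntres hc.2, min_eq_left (by omega), max_eq_right (by omega)]
    have : residueFieldCard F * 1 = residueFieldCard F := mul_one _
    omega
  rw [serreWeightLocal, if_neg h2, if_neg hw]
  refine le_antisymm (Nat.sInf_le hmem) (le_csInf ⟨_, hmem⟩ ?_)
  -- every other normalisation gives the same exponents, hence the same weight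
  rintro m ⟨-, α', β', hα', hβ'1, hβ'q, ⟨ϖ', hϖ', hshape⟩, rfl⟩
  obtain ⟨hβ, hα⟩ :=
    HasLevelOneInertiaShape.fundamentalCharacter_pow_eq_of_not_isTamelyRamified hw hϖ hϖ' h hshape
  -- `β' = q - 1`
  have hβ' : β' = residueFieldCard F - 1 := by
    have h1 : fundamentalCharacter F 1 ι ϖ hϖ ^ β' = 1 := by
      ext σ : 1
      rw [MonoidHom.pow_apply, MonoidHom.one_apply, ← hβ σ, ← MonoidHom.pow_apply,
        fundamentalCharacter_one_pow_eq_one (F := F) ι ϖ hϖ, MonoidHom.one_apply]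
    have hdvd := (fundamentalCharacter_one_pow_eq_one_iff ι hι ϖ hϖ β').mp h1
    obtain ⟨c, hc⟩ := hdvd
    rcases Nat.eq_zero_or_pos c with rfl | hcpos
    · omega
    · have : residueFieldCard F - 1 ≤ β' := by
        calc residueFieldCard F - 1 = (residueFieldCard F - 1) * 1 := (mul_one _).symm
          _ ≤ (residueFieldCard F - 1) * c := Nat.mul_le_mul_left _ hcpos
          _ = β' := hc.symm
      omega
  -- `α' = 1`
  have hα' : α' = 1 := by
    rcases Nat.eq_zero_or_pos α' with hα0 | hαpos
    · exfalso
      apply fundamentalCharacter_one_ne_one ι hι ϖ hϖ hq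
      ext σ : 1
      rw [MonoidHom.one_apply, ← pow_one (fundamentalCharacter F 1 ι ϖ hϖ σ), hα σ, hα0, pow_zero]
    · have h1 : fundamentalCharacter F 1 ι ϖ hϖ ^ (α' - 1) = 1 := by
        ext σ : 1
        rw [MonoidHom.pow_apply, MonoidHom.one_apply]
        have h3 := hα σ
        rw [pow_one] at h3
        have h4 : fundamentalCharacter F 1 ι ϖ hϖ σ ^ α' =
            fundamentalCharacter F 1 ι ϖ hϖ σ ^ (α' - 1) * fundamentalCharacter F 1 ι ϖ hϖ σ := by
          rw [← pow_succ, Nat.sub_add_cancel hαpos]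
        rw [h4] at h3
        exact mul_right_cancel (h3.symm.trans (one_mul _).symm)
      have hdvd := (fundamentalCharacter_one_pow_eq_one_iff ι hι ϖ hϖ (α' - 1)).mp h1
      have hlt : α' - 1 < residueFieldCard F - 1 := by omega
      have h0 := Nat.eq_zero_of_dvd_of_lt hdvd hlt
      omega
  subst hβ' hα'
  rw [if_neg fun hc ↦ hntres hc.2, min_eq_left (by omega), max_eq_right (by omega)]
  have : residueFieldCard F * 1 = residueFieldCard F := mul_one _
  omega

end ModPGaloisRep
end Literature.NumberTheory.GaloisRepresentations

end
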